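import Mathlib
import HarnessLib

/-!
# WallMajorant

Topic `Literature/Uncategorized`. Named literature fact(s) relocated by the gate from `Summits/FinalStateConjecture/FinalStateConjecture/Theorems/StarvedNecksNeckGapDecayStubWallMajorant.lean`
(accept-time relocation of `[cite]`d propositions written inline in a Summits proposal; human ruling 2026-08-15).

* `Literature.Uncategorized.WallMajorant`
-/

namespace Literature.Uncategorized

open Filter Set Topology

/-- **S1 — normalised wall majorant** (the statement registered on the crux, verbatim): a sublinear
profile `ρ(t)/t → 0` admits, for every `ε > 0` and floor `R`, a continuous, non-decreasing,
sublinear wall `W ≥ R` of slope `≤ ε` with `3ρ + 2 ≤ W` from some threshold on (the `ε`-Lipschitz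
upper envelope of the running maximum; birth's W0 normalisation). [folklore] -/
def WallMajorant : Prop :=
  ∀ ρ : ℝ → ℝ, Tendsto (fun t ↦ ρ t / t) atTop (𝓝 0) → ∀ (ε R : ℝ), 0 < ε →
    ∃ (T₀ : ℝ) (W : ℝ → ℝ), Continuous W ∧ Monotone W ∧ Tendsto (fun s ↦ W s / s) atTop (𝓝 0) ∧
      (∀ s s', s ≤ s' → W s' ≤ W s + ε * (s' - s)) ∧ (∀ s, R ≤ W s) ∧ ∀ s, T₀ ≤ s → 3 * ρ s + 2 ≤ W s

/-! ### Proof of `WallMajorant`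

Elementary and self-contained ([folklore]).  The wall is the one-sided version of the classical
`ε`-Lipschitz upper envelope `x ↦ sup_y (g y - ε d(x, y))` (the McShane–Whitney extension formula,
E. J. McShane, *Extension of range of functions*, Bull. Amer. Math. Soc. 40 (1934) 837–842),
which for a one-sided penalty automatically contains the running maximum.

Write `f := 3ρ + 2`, still `f t / t → 0`.  Fix `T₀ ≥ 1` with `f u ≤ ε u` for `u ≥ T₀`, freeze and
floor the profile, `F u := max (f (max u T₀)) R`, and put
`W s := ⨆ u, (F u - ε * max (u - s) 0)`.
* each term is `≤ ε * max s T₀ + |R|`, so the supremum is a real supremum;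
* the term `u = s` gives `W ≥ F ≥ R` and `W s ≥ f s` for `s ≥ T₀`;
* `s ↦ -max (u - s) 0` is non-decreasing and `1`-Lipschitz from above, whence `W` is monotone with
  `W s' ≤ W s + ε (s' - s)`, hence `ε`-Lipschitz and continuous;
* for `δ ≤ ε` and `T'` with `f u ≤ (δ/2) u` beyond `T'`, every term is
  `≤ (δ/2) s + ε T' + |R|` once `s ≥ T'`, so `W s ≤ δ s` eventually: `W s / s → 0`.
-/

section WallProof

variable {G W : ℝ → ℝ} {ε : ℝ}

/-! The one-sided `ε`-Lipschitz upper envelope `W s = sup_u (G u - ε (u - s)⁺)`, handled through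
its defining equation `hW` (no auxiliary definition is introduced). -/

/-- The envelope majorises the profile: `G s ≤ W s` (term `u = s`). [folklore] -/
private lemma env_ge (hW : ∀ s, W s = ⨆ u, (G u - ε * max (u - s) 0))
    (hB : ∀ s, BddAbove (range fun u ↦ G u - ε * max (u - s) 0)) (s : ℝ) : G s ≤ W s := by
  have := le_ciSup (hB s) s
  rw [hW]
  simpa using this

/-- A uniform bound on the terms bounds the envelope. [folklore] -/
private lemma env_le (hW : ∀ s, W s = ⨆ u, (G u - ε * max (u - s) 0)) {s B : ℝ}
    (h : ∀ u, G u - ε * max (u - s) 0 ≤ B) : W s ≤ B := by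
  rw [hW]
  exact ciSup_le h

/-- The one-sided envelope is non-decreasing (the penalty `ε (u - s)⁺` is non-increasing in `s`).
[folklore] -/
private lemma env_mono (hW : ∀ s, W s = ⨆ u, (G u - ε * max (u - s) 0)) (hε : 0 ≤ ε)
    (hB : ∀ s, BddAbove (range fun u ↦ G u - ε * max (u - s) 0)) : Monotone W := by
  intro s s' hss'
  rw [hW, hW]
  refine ciSup_mono (hB s') fun u ↦ ?_
  have h1 : max (u - s') 0 ≤ max (u - s) 0 := max_le_max (by linarith) le_rfl
  have h2 : ε * max (u - s') 0 ≤ ε * max (u - s) 0 := mul_le_mul_of_nonneg_left h1 hε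
  linarith

/-- The envelope has slope at most `ε`: `W s' ≤ W s + ε (s' - s)` for `s ≤ s'`. [folklore] -/
private lemma env_lip (hW : ∀ s, W s = ⨆ u, (G u - ε * max (u - s) 0)) (hε : 0 ≤ ε)
    (hB : ∀ s, BddAbove (range fun u ↦ G u - ε * max (u - s) 0)) {s s' : ℝ} (hss' : s ≤ s') :
    W s' ≤ W s + ε * (s' - s) := by
  rw [hW, hW]
  refine ciSup_le fun u ↦ ?_
  have h1 : max (u - s) 0 ≤ max (u - s') 0 + (s' - s) :=
    max_le (by linarith [le_max_left (u - s') 0]) (by linarith [le_max_right (u - s') 0])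
  have h2 : ε * max (u - s) 0 ≤ ε * (max (u - s') 0 + (s' - s)) := mul_le_mul_of_nonneg_left h1 hε
  have h3 : G u - ε * max (u - s) 0 ≤ ⨆ u, (G u - ε * max (u - s) 0) := le_ciSup (hB s) u
  rw [mul_add] at h2
  linarith

/-- Monotone with slope `≤ ε`, the envelope is `ε`-Lipschitz, hence continuous. [folklore] -/
private lemma env_continuous (hW : ∀ s, W s = ⨆ u, (G u - ε * max (u - s) 0)) (hε : 0 ≤ ε)
    (hB : ∀ s, BddAbove (range fun u ↦ G u - ε * max (u - s) 0)) : Continuous W := by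
  have hlip : LipschitzWith (Real.toNNReal ε) W := by
    refine LipschitzWith.of_le_add_mul _ fun x y ↦ ?_
    rw [Real.coe_toNNReal _ hε, Real.dist_eq]
    rcases le_total x y with h | h
    · have h1 := env_mono hW hε hB h
      have h2 : 0 ≤ ε * |x - y| := mul_nonneg hε (abs_nonneg _)
      linarith
    · have h1 := env_lip hW hε hB h
      rw [abs_of_nonneg (by linarith)]
      linarith
  exact hlip.continuous

/-- The wall for a general sublinear profile `f` (`WallMajorant` is the case `f = 3ρ + 2`):
continuous, monotone, sublinear, slope `≤ ε`, above the floor `R`, and above `f` from a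
threshold on. [folklore] -/
private theorem wall_of_sublinear (f : ℝ → ℝ) (hf : Tendsto (fun t ↦ f t / t) atTop (𝓝 0))
    (ε R : ℝ) (hε : 0 < ε) :
    ∃ (T₀ : ℝ) (W : ℝ → ℝ), Continuous W ∧ Monotone W ∧ Tendsto (fun s ↦ W s / s) atTop (𝓝 0) ∧
      (∀ s s', s ≤ s' → W s' ≤ W s + ε * (s' - s)) ∧ (∀ s, R ≤ W s) ∧
      ∀ s, T₀ ≤ s → f s ≤ W s := by
  -- `f u ≤ δ u` beyond a threshold, for every `δ > 0`
  have hev : ∀ δ : ℝ, 0 < δ → ∀ T : ℝ, ∃ T', T ≤ T' ∧ 1 ≤ T' ∧ ∀ u, T' ≤ u → f u ≤ δ * u := by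
    intro δ hδ T
    have h1 : ∀ᶠ t in atTop, f t / t ≤ δ := hf.eventually (eventually_le_nhds hδ)
    obtain ⟨T₁, hT₁⟩ := eventually_atTop.1 (h1.and (eventually_ge_atTop 1))
    refine ⟨max (max T 1) T₁, le_trans (le_max_left _ _) (le_max_left _ _),
      le_trans (le_max_right _ _) (le_max_left _ _), fun u hu ↦ ?_⟩
    obtain ⟨hu1, hu2⟩ := hT₁ u (le_trans (le_max_right _ _) hu)
    rwa [div_le_iff₀ (by linarith)] at hu1
  obtain ⟨T₀, -, hT₀1, hT₀⟩ := hev ε hε 0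
  -- the frozen, floored profile `F` and its envelope `W`
  obtain ⟨F, hF⟩ : ∃ F : ℝ → ℝ, ∀ u, F u = max (f (max u T₀)) R := ⟨_, fun _ ↦ rfl⟩
  obtain ⟨W, hW⟩ : ∃ W : ℝ → ℝ, ∀ s, W s = ⨆ u, (F u - ε * max (u - s) 0) := ⟨_, fun _ ↦ rfl⟩
  have hmax : ∀ u s, max u T₀ ≤ max (u - s) 0 + max s T₀ := by
    intro u s
    rcases le_total u T₀ with h | h
    · rw [max_eq_right h]; linarith [le_max_right (u - s) 0, le_max_right s T₀]
    · rw [max_eq_left h]; linarith [le_max_left (u - s) 0, le_max_left s T₀]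
  have hFle : ∀ u, F u ≤ ε * max u T₀ + |R| := by
    intro u
    have hv : T₀ ≤ max u T₀ := le_max_right _ _
    have h1 : f (max u T₀) ≤ ε * max u T₀ := hT₀ _ hv
    have h2 : 0 ≤ ε * max u T₀ := mul_nonneg hε.le (by linarith)
    rw [hF]
    exact max_le (by linarith [abs_nonneg R]) (by linarith [le_abs_self R])
  have hB : ∀ s, BddAbove (range fun u ↦ F u - ε * max (u - s) 0) := by
    intro s
    refine ⟨ε * max s T₀ + |R|, ?_⟩
    rintro _ ⟨u, rfl⟩
    have h3 : ε * max u T₀ ≤ ε * max (u - s) 0 + ε * max s T₀ := by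
      rw [← mul_add]; exact mul_le_mul_of_nonneg_left (hmax u s) hε.le
    have h4 := hFle u
    dsimp only
    linarith
  have hlower : ∀ s, R ≤ W s :=
    fun s ↦ le_trans (by rw [hF]; exact le_max_right _ _) (env_ge hW hB s)
  -- eventual bound `W s ≤ δ s`
  have hupper : ∀ δ : ℝ, 0 < δ → ∃ S, ∀ s, S ≤ s → W s ≤ δ * s := by
    intro δ hδ
    obtain ⟨δ', hδ'pos, hδ'δ, hδ'ε⟩ : ∃ δ', 0 < δ' ∧ δ' ≤ δ ∧ δ' ≤ ε :=
      ⟨min δ ε, lt_min hδ hε, min_le_left _ _, min_le_right _ _⟩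
    obtain ⟨T', hT'T₀, hT'1, hT'⟩ := hev (δ' / 2) (by positivity) T₀
    refine ⟨max T' (2 * (ε * T' + |R|) / δ'), fun s hs ↦ ?_⟩
    have hsT' : T' ≤ s := le_trans (le_max_left _ _) hs
    have hs2 : 2 * (ε * T' + |R|) / δ' ≤ s := le_trans (le_max_right _ _) hs
    rw [div_le_iff₀ hδ'pos] at hs2
    have hεT' : 0 ≤ ε * T' := mul_nonneg hε.le (by linarith)
    have h6 : δ' * s ≤ δ * s := mul_le_mul_of_nonneg_right hδ'δ (by linarith)
    refine le_trans (env_le hW (B := δ' / 2 * s + (ε * T' + |R|)) fun u ↦ ?_) (by linarith)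
    rcases le_or_gt T' (max u T₀) with h | h
    · -- far regime: `f ≤ (δ'/2) ·` at `max u T₀`
      have h1 : f (max u T₀) ≤ δ' / 2 * max u T₀ := hT' _ h
      have h0 : 0 ≤ δ' / 2 * max u T₀ := mul_nonneg (by positivity) (by linarith)
      have hF1 : F u ≤ δ' / 2 * max u T₀ + |R| := by
        rw [hF]
        exact max_le (by linarith [abs_nonneg R]) (by linarith [le_abs_self R])
      have h2 : max u T₀ ≤ max (u - s) 0 + s := by
        have := hmax u s
        rwa [max_eq_left (le_trans hT'T₀ hsT')] at this
      have h3 : δ' / 2 * max u T₀ ≤ δ' / 2 * max (u - s) 0 + δ' / 2 * s := by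
        rw [← mul_add]; exact mul_le_mul_of_nonneg_left h2 (by positivity)
      have h4 : δ' / 2 * max (u - s) 0 ≤ ε * max (u - s) 0 :=
        mul_le_mul_of_nonneg_right (by linarith) (le_max_right _ _)
      linarith
    · -- near regime: `max u T₀ < T'`, where `F ≤ ε T' + |R|`
      have hv : T₀ ≤ max u T₀ := le_max_right _ _
      have h1 : f (max u T₀) ≤ ε * max u T₀ := hT₀ _ hv
      have h1' : ε * max u T₀ ≤ ε * T' := mul_le_mul_of_nonneg_left h.le hε.le
      have hF1 : F u ≤ ε * T' + |R| := by
        rw [hF]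
        exact max_le (by linarith [abs_nonneg R]) (by linarith [le_abs_self R])
      have h2 : 0 ≤ ε * max (u - s) 0 := mul_nonneg hε.le (le_max_right _ _)
      have h3 : 0 ≤ δ' / 2 * s := mul_nonneg (by positivity) (by linarith)
      linarith
  refine ⟨T₀, W, env_continuous hW hε.le hB, env_mono hW hε.le hB, ?_,
    fun s s' h ↦ env_lip hW hε.le hB h, hlower, fun s hs ↦ ?_⟩
  · rw [tendsto_order]
    refine ⟨fun a ha ↦ ?_, fun b hb ↦ ?_⟩
    · have h1 : Tendsto (fun s : ℝ ↦ R / s) atTop (𝓝 0) := tendsto_const_nhds.div_atTop tendsto_id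
      filter_upwards [h1.eventually (eventually_gt_nhds ha), eventually_gt_atTop 0] with s hs hs0
      calc a < R / s := hs
        _ ≤ W s / s := div_le_div_of_nonneg_right (hlower s) hs0.le
    · obtain ⟨S, hS⟩ := hupper (b / 2) (by positivity)
      filter_upwards [eventually_ge_atTop S, eventually_gt_atTop 0] with s hs hs0
      calc W s / s ≤ b / 2 * s / s := div_le_div_of_nonneg_right (hS s hs) hs0.le
        _ = b / 2 := by field_simp
        _ < b := by linarith
  · have h1 : f s ≤ F s := by rw [hF, max_eq_left hs]; exact le_max_left _ _
    exact le_trans h1 (env_ge hW hB s)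

end WallProof

/-- **S1 — normalised wall majorant** holds: discharge of `WallMajorant` ([folklore]; one-sided
McShane/Pasch–Hausdorff `ε`-Lipschitz upper envelope of the frozen, floored profile). -/
theorem WallMajorant_holds : WallMajorant := by
  intro ρ hρ ε R hε
  have hf : Tendsto (fun t ↦ (3 * ρ t + 2) / t) atTop (𝓝 0) := by
    have h1 : Tendsto (fun t : ℝ ↦ (2 : ℝ) / t) atTop (𝓝 0) :=
      tendsto_const_nhds.div_atTop tendsto_id
    have h2 := (hρ.const_mul 3).add h1
    rw [mul_zero, add_zero] at h2
    have h3 : (fun t : ℝ ↦ (3 * ρ t + 2) / t) = fun t ↦ 3 * (ρ t / t) + 2 / t := by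
      funext t; ring
    rw [h3]; exact h2
  exact wall_of_sublinear (fun t ↦ 3 * ρ t + 2) hf ε R hε

end Literature.Uncategorized
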